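import Summits.ABC.StewartYu.RecordAssembly
import HarnessLib

/-!
# Cell abc-stewartyu, Gen-3 frames (cruxes `Y07Odd`/`Y07Two`): the RECORD's exit inequalities (A), (B)
# from FOUR SCALAR PREMISES — the numerics of Nesterenko's Lemmas 5.3 / 5.4 once and for all

`Summits/ABC/StewartYu/RecordExitsNumeric.lean` — cell `abc-stewartyu` (HOME `run/shared/lean/pub/abc-stewartyu/`),
route `PadicPrimesKummerThird`, cruxes `Y07Odd` (stmt-ABC-19658) / `Y07Two` (stmt-ABC-19659); seat lp-1 (g2), record
parcel (R2) (plan g8 2026-08-26T23:38:58Z).  Theorems only, pure `ℕ`-arithmetic, place-free.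

p4's `RecordAssembly.recordTwo_of_ineqs` / `recordOdd_of_ineqs` (p473088) reduce the record predicates
`RecordTwo`/`RecordOdd` to three scalar inequalities; the first two are, for END parameters `(D₀, S₀, X, D)`,
a uniform degree bound `Dⱼ ≤ Dmax` and all `r ≤ n`, `d₀ ≤ 1`:

* (A) `(n+1)!·2ⁿ·D₀·Dmax^r < C(S₀+(r+1−d₀), r+1−d₀)·(2X+1)·((d₀+(n−r))!·2^{n−r}·D₀^{d₀})` (exit A: Lemma 5.3),
* (B) `(n+1)!·2ⁿ·D₀·∏ⱼ Dⱼ < C(S₀+(n−d₀), n−d₀)·(2X+1)·(d₀!·D₀^{d₀})` (exit B, `r = n`: Lemma 5.4).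

This file proves them from premises a parameter ledger can check line by line:

* `exitA_of_bounds` — (A) for ALL `(r, d₀)` from `1 ≤ X`, `1 ≤ D₀`,
  (K1) `2n(n+1)·Dmax ≤ S₀ + 1` and (K2) `(n+1)²·D₀ < (S₀+1)·(2X+1)`.
  Mechanism (print, (5.13)–(5.17)): `ℓ!·C(S₀+ℓ, ℓ) ≥ (S₀+1)^ℓ` (`pow_le_factorial_mul_choose`),
  `(n+1)! ≤ (n+1)^j·(n+1−j)!`, `r! ≤ nʳ`; with `ℓ = r+1−d₀` each of the `r` lattice directions costs a factor
  `2n(n+1)·Dmax/(S₀+1) ≤ 1` (K1) and the additive direction (`d₀ = 0`) costs `(n+1)²D₀/((S₀+1)(2X+1)) < 1` (K2).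
* `exitB_of_bounds` — (B) from a product bound `∏ Dⱼ ≤ PD` and the two lines
  `(n+1)!·n!·2ⁿ·D₀·PD < (S₀+1)ⁿ·(2X+1)` (`d₀ = 0`, `G* = {e}`) and `(n+1)!·(n−1)!·2ⁿ·PD < (S₀+1)^{n−1}·(2X+1)`
  (`d₀ = 1`, `G* = 𝔾ₐ`).
* `pow_five_le_two_pow` — the one polynomial-vs-exponential fact the instantiations need: `(n+2)⁵ ≤ 2^{n+24}`.

The instantiation from a parameter record (`PadicG3Par`: `S₀ = ⌊M/(n+2)⁴⌋`, `Dmax ≈ L/2^{n+22}`,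
`2X+1 ≥ 2^{Ŝ−1}X₀`, `D₀ ≤ X₀L/4 + 2`) is a separate short file; (K1)/(K2) hold there with room `2^{n+20}`,
while (B) needs the depth `Ŝ` to absorb the class count (STATUS lp-1 2026-08-27T00:2xZ).

WHAT THIS IS NOT: no parameter choice; no crux moves.

References: Yu. V. Nesterenko, LNM 1819 (2003), §5.2 (5.13)–(5.18), Lemmas 5.3, 5.4.
-/

open Finset Nat

namespace Summit.ABC.StewartYu.RecordExitsNumeric

/-! ### Combinatorial lemmas -/

/-- `(S₀+1)^ℓ ≤ ℓ! · C(S₀+ℓ, ℓ)` (the ascending factorial `(S₀+1)⋯(S₀+ℓ)` dominates `(S₀+1)^ℓ`).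
[cite: Nesterenko2003, §5.2 (5.13)] -/
theorem pow_le_factorial_mul_choose (S₀ ℓ : ℕ) : (S₀ + 1) ^ ℓ ≤ ℓ ! * (S₀ + ℓ).choose ℓ := by
  rw [← Nat.ascFactorial_eq_factorial_mul_choose]
  exact Nat.pow_succ_le_ascFactorial (S₀ + 1) ℓ

/-- `(n+1)! ≤ (n+1)^j · (n+1−j)!` for `j ≤ n+1`. [folklore] -/
theorem factorial_le_pow_mul_factorial {n j : ℕ} (hj : j ≤ n + 1) :
    (n + 1)! ≤ (n + 1) ^ j * (n + 1 - j)! := by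
  rw [← Nat.factorial_mul_descFactorial hj, mul_comm ((n + 1) ^ j)]
  exact Nat.mul_le_mul_left _ (Nat.descFactorial_le_pow _ _)

/-- `r! ≤ nʳ` for `r ≤ n`. [folklore] -/
theorem factorial_le_pow_of_le {r n : ℕ} (hr : r ≤ n) : r ! ≤ n ^ r :=
  (Nat.factorial_le_pow r).trans (Nat.pow_le_pow_left hr r)

/-- `(r+1)! ≤ (n+1) · nʳ` for `r ≤ n`. [folklore] -/
theorem factorial_succ_le {r n : ℕ} (hr : r ≤ n) : (r + 1)! ≤ (n + 1) * n ^ r := by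
  rw [Nat.factorial_succ]
  exact Nat.mul_le_mul (by omega) (factorial_le_pow_of_le hr)

/-! ### Exit A (Lemma 5.3) -/

/-- **Exit A from (K1) and (K2).**  For `1 ≤ X`, `1 ≤ D₀`, (K1) `2n(n+1)·Dmax ≤ S₀+1` and
(K2) `(n+1)²·D₀ < (S₀+1)·(2X+1)`, the exit-A inequality of the record holds for every `r ≤ n`, `d₀ ≤ 1`
— hypothesis `hA` of `RecordAssembly.recordTwo_of_ineqs` / `recordOdd_of_ineqs` verbatim.
[cite: Nesterenko2003, §5.2 Lemma 5.3, (5.13)–(5.17)] -/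
theorem exitA_of_bounds {n S₀ X D₀ Dmax : ℕ} (hX : 1 ≤ X) (hD₀ : 1 ≤ D₀)
    (hK1 : 2 * n * (n + 1) * Dmax ≤ S₀ + 1) (hK2 : (n + 1) ^ 2 * D₀ < (S₀ + 1) * (2 * X + 1)) :
    ∀ r d₀ : ℕ, r ≤ n → d₀ ≤ 1 →
      (n + 1).factorial * 2 ^ n * D₀ * Dmax ^ r <
        Nat.choose (S₀ + (r + 1 - d₀)) (r + 1 - d₀) * (2 * X + 1) *
          ((d₀ + (n - r)).factorial * 2 ^ (n - r) * D₀ ^ d₀) := by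
  intro r d₀ hr hd₀
  -- the `r` lattice directions: `(2n(n+1) Dmax)^r ≤ (S₀+1)^r`
  have hK1r : 2 ^ r * n ^ r * (n + 1) ^ r * Dmax ^ r ≤ (S₀ + 1) ^ r := by
    simpa only [mul_pow] using Nat.pow_le_pow_left hK1 r
  have hrfac : r ! ≤ n ^ r := factorial_le_pow_of_le hr
  have h2n : 2 ^ n = 2 ^ r * 2 ^ (n - r) := by rw [← pow_add, Nat.add_sub_cancel' hr]
  rcases Nat.le_one_iff_eq_zero_or_eq_one.mp hd₀ with rfl | rfl
  · -- `d₀ = 0`, `ℓ = r + 1`: multiply the goal by `(r+1)!`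
    simp only [Nat.sub_zero, zero_add, pow_zero, mul_one]
    have hfac : (n + 1)! ≤ (n + 1) ^ (r + 1) * (n - r)! := by
      have := factorial_le_pow_mul_factorial (n := n) (j := r + 1) (by omega)
      simpa [Nat.add_sub_add_right] using this
    have hℓ : 0 < (r + 1)! := Nat.factorial_pos _
    refine Nat.lt_of_mul_lt_mul_left (a := (r + 1)!) ?_
    have hchoose := pow_le_factorial_mul_choose S₀ (r + 1)
    -- LHS chain
    calc (r + 1)! * ((n + 1)! * 2 ^ n * D₀ * Dmax ^ r)
        ≤ ((n + 1) * n ^ r) * (((n + 1) ^ (r + 1) * (n - r)!) * 2 ^ n * D₀ * Dmax ^ r) :=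
          Nat.mul_le_mul (factorial_succ_le hr) (by gcongr)
      _ = ((n + 1) ^ 2 * D₀) * ((2 ^ r * n ^ r * (n + 1) ^ r * Dmax ^ r) * ((n - r)! * 2 ^ (n - r))) := by
          rw [h2n]; ring
      _ < ((S₀ + 1) * (2 * X + 1)) * ((S₀ + 1) ^ r * ((n - r)! * 2 ^ (n - r))) := by
          apply Nat.mul_lt_mul_of_lt_of_le hK2 (Nat.mul_le_mul_right _ hK1r)
          exact Nat.mul_pos (by positivity) (Nat.mul_pos (Nat.factorial_pos _) (by positivity))
      _ = (S₀ + 1) ^ (r + 1) * (2 * X + 1) * ((n - r)! * 2 ^ (n - r)) := by ring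
      _ ≤ ((r + 1)! * (S₀ + (r + 1)).choose (r + 1)) * (2 * X + 1) * ((n - r)! * 2 ^ (n - r)) := by
          gcongr
      _ = (r + 1)! * ((S₀ + (r + 1)).choose (r + 1) * (2 * X + 1) * ((n - r)! * 2 ^ (n - r))) := by
          ring
  · -- `d₀ = 1`, `ℓ = r`: multiply the goal by `r!`
    simp only [Nat.add_sub_cancel, pow_one]
    have hfac : (n + 1)! ≤ (n + 1) ^ r * (n + 1 - r)! := factorial_le_pow_mul_factorial (by omega)
    have e1 : 1 + (n - r) = n + 1 - r := by omega
    rw [e1]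
    refine Nat.lt_of_mul_lt_mul_left (a := r !) ?_
    have hchoose := pow_le_factorial_mul_choose S₀ r
    have hpos : 0 < (S₀ + 1) ^ r * ((n + 1 - r)! * 2 ^ (n - r) * D₀) :=
      Nat.mul_pos (by positivity) (Nat.mul_pos (Nat.mul_pos (Nat.factorial_pos _) (by positivity)) (by omega))
    calc r ! * ((n + 1)! * 2 ^ n * D₀ * Dmax ^ r)
        ≤ n ^ r * (((n + 1) ^ r * (n + 1 - r)!) * 2 ^ n * D₀ * Dmax ^ r) :=
          Nat.mul_le_mul hrfac (by gcongr)
      _ = (2 ^ r * n ^ r * (n + 1) ^ r * Dmax ^ r) * ((n + 1 - r)! * 2 ^ (n - r) * D₀) := by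
          rw [h2n]; ring
      _ ≤ (S₀ + 1) ^ r * ((n + 1 - r)! * 2 ^ (n - r) * D₀) := Nat.mul_le_mul_right _ hK1r
      _ = (S₀ + 1) ^ r * ((n + 1 - r)! * 2 ^ (n - r) * D₀) * 1 := (mul_one _).symm
      _ < (S₀ + 1) ^ r * ((n + 1 - r)! * 2 ^ (n - r) * D₀) * (2 * X + 1) :=
          Nat.mul_lt_mul_of_pos_left (by omega) hpos
      _ ≤ (r ! * (S₀ + r).choose r) * ((n + 1 - r)! * 2 ^ (n - r) * D₀) * (2 * X + 1) := by gcongr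
      _ = r ! * ((S₀ + r).choose r * (2 * X + 1) * ((n + 1 - r)! * 2 ^ (n - r) * D₀)) := by ring

/-! ### Exit B (Lemma 5.4) -/

/-- **Exit B from two scalar lines.**  With a product bound `∏ Dⱼ ≤ PD`:
`(n+1)!·n!·2ⁿ·D₀·PD < (S₀+1)ⁿ·(2X+1)` (the trivial subgroup, `d₀ = 0`) and
`(n+1)!·(n−1)!·2ⁿ·PD < (S₀+1)^{n−1}·(2X+1)` (the additive group, `d₀ = 1`) give hypothesis `hB` of
`RecordAssembly.recordTwo_of_ineqs` / `recordOdd_of_ineqs` verbatim (`1 ≤ D₀`).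
[cite: Nesterenko2003, §5.2 Lemma 5.4, (5.18)] -/
theorem exitB_of_bounds {n S₀ X D₀ PD : ℕ} {D : Fin n → ℕ} (hD₀ : 1 ≤ D₀) (hPD : ∏ j, D j ≤ PD)
    (hB0 : (n + 1)! * n ! * 2 ^ n * D₀ * PD < (S₀ + 1) ^ n * (2 * X + 1))
    (hB1 : (n + 1)! * (n - 1)! * 2 ^ n * PD < (S₀ + 1) ^ (n - 1) * (2 * X + 1)) :
    ∀ d₀ : ℕ, d₀ ≤ 1 →
      (n + 1).factorial * 2 ^ n * D₀ * ∏ j, D j <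
        Nat.choose (S₀ + (n - d₀)) (n - d₀) * (2 * X + 1) * (d₀.factorial * D₀ ^ d₀) := by
  intro d₀ hd₀
  rcases Nat.le_one_iff_eq_zero_or_eq_one.mp hd₀ with rfl | rfl
  · -- `d₀ = 0`: multiply by `n!`
    simp only [Nat.sub_zero, Nat.factorial_zero, pow_zero, mul_one]
    refine Nat.lt_of_mul_lt_mul_left (a := n !) ?_
    calc n ! * ((n + 1)! * 2 ^ n * D₀ * ∏ j, D j)
        ≤ n ! * ((n + 1)! * 2 ^ n * D₀ * PD) := by gcongr
      _ = (n + 1)! * n ! * 2 ^ n * D₀ * PD := by ring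
      _ < (S₀ + 1) ^ n * (2 * X + 1) := hB0
      _ ≤ (n ! * (S₀ + n).choose n) * (2 * X + 1) :=
          Nat.mul_le_mul_right _ (pow_le_factorial_mul_choose S₀ n)
      _ = n ! * ((S₀ + n).choose n * (2 * X + 1)) := by ring
  · -- `d₀ = 1`: multiply by `(n-1)!`
    simp only [Nat.factorial_one, pow_one, one_mul]
    refine Nat.lt_of_mul_lt_mul_left (a := (n - 1)!) ?_
    calc (n - 1)! * ((n + 1)! * 2 ^ n * D₀ * ∏ j, D j)
        ≤ (n - 1)! * ((n + 1)! * 2 ^ n * D₀ * PD) := by gcongr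
      _ = ((n + 1)! * (n - 1)! * 2 ^ n * PD) * D₀ := by ring
      _ < ((S₀ + 1) ^ (n - 1) * (2 * X + 1)) * D₀ := Nat.mul_lt_mul_of_pos_right hB1 (by omega)
      _ ≤ (((n - 1)! * (S₀ + (n - 1)).choose (n - 1)) * (2 * X + 1)) * D₀ := by
          gcongr; exact pow_le_factorial_mul_choose S₀ (n - 1)
      _ = (n - 1)! * ((S₀ + (n - 1)).choose (n - 1) * (2 * X + 1) * D₀) := by ring

/-! ### The polynomial-versus-exponential fact for the instantiations -/

/-- `(x+1)⁵ ≤ 2 x⁵` for `x ≥ 7`. [folklore] -/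
theorem succ_pow_five_le {x : ℕ} (hx : 7 ≤ x) : (x + 1) ^ 5 ≤ 2 * x ^ 5 := by
  have h1 : 5 * x ^ 4 + 10 * x ^ 3 + 10 * x ^ 2 + 5 * x + 1 ≤ x ^ 5 := by
    have h4 : 7 * x ^ 4 ≤ x ^ 5 := by
      calc 7 * x ^ 4 ≤ x * x ^ 4 := Nat.mul_le_mul_right _ hx
        _ = x ^ 5 := by ring
    have h3 : 7 * x ^ 3 ≤ x ^ 4 := by
      calc 7 * x ^ 3 ≤ x * x ^ 3 := Nat.mul_le_mul_right _ hx
        _ = x ^ 4 := by ring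
    have h2 : 7 * x ^ 2 ≤ x ^ 3 := by
      calc 7 * x ^ 2 ≤ x * x ^ 2 := Nat.mul_le_mul_right _ hx
        _ = x ^ 3 := by ring
    have h1 : 7 * x ≤ x ^ 2 := by
      calc 7 * x ≤ x * x := Nat.mul_le_mul_right _ hx
        _ = x ^ 2 := by ring
    nlinarith
  calc (x + 1) ^ 5 = x ^ 5 + (5 * x ^ 4 + 10 * x ^ 3 + 10 * x ^ 2 + 5 * x + 1) := by ring
    _ ≤ x ^ 5 + x ^ 5 := Nat.add_le_add_left h1 _
    _ = 2 * x ^ 5 := by ring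

/-- **`(n+2)⁵ ≤ 2^{n+24}`** for every `n` (the only growth comparison the record's exits need:
`n(n+2)⁴`, `(n+1)(n+2)⁴ ≤ (n+2)⁵`). [folklore] -/
theorem pow_five_le_two_pow (n : ℕ) : (n + 2) ^ 5 ≤ 2 ^ (n + 24) := by
  induction n with
  | zero => norm_num
  | succ k ih =>
    by_cases hk : 5 ≤ k
    · calc (k + 1 + 2) ^ 5 = (k + 2 + 1) ^ 5 := by ring
        _ ≤ 2 * (k + 2) ^ 5 := succ_pow_five_le (by omega)
        _ ≤ 2 * 2 ^ (k + 24) := Nat.mul_le_mul_left _ ih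
        _ = 2 ^ (k + 1 + 24) := by ring
    · interval_cases k <;> norm_num

/-- `n · (n+2)⁴ ≤ 2^{n+24}`. [folklore] -/
theorem mul_pow_four_le_two_pow (n : ℕ) : n * (n + 2) ^ 4 ≤ 2 ^ (n + 24) := by
  calc n * (n + 2) ^ 4 ≤ (n + 2) * (n + 2) ^ 4 := Nat.mul_le_mul_right _ (by omega)
    _ = (n + 2) ^ 5 := by ring
    _ ≤ 2 ^ (n + 24) := pow_five_le_two_pow n

/-- `(n+1) · (n+2)⁴ ≤ 2^{n+24}`. [folklore] -/
theorem succ_mul_pow_four_le_two_pow (n : ℕ) : (n + 1) * (n + 2) ^ 4 ≤ 2 ^ (n + 24) := by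
  calc (n + 1) * (n + 2) ^ 4 ≤ (n + 2) * (n + 2) ^ 4 := Nat.mul_le_mul_right _ (by omega)
    _ = (n + 2) ^ 5 := by ring
    _ ≤ 2 ^ (n + 24) := pow_five_le_two_pow n

end Summit.ABC.StewartYu.RecordExitsNumeric
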